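import Mathlib.RingTheory.AdjoinRoot
import Mathlib.Algebra.Polynomial.Div
import Mathlib.Tactic.ComputeDegree
import Mathlib.Data.Fintype.Prod
import Mathlib.Data.ZMod.Defs
import HarnessLib

/-!
# The rank-`5` algebra `R[t]/(t⁵ - p₄t⁴ - p₃t³ - p₂t² - p₁t - p₀)` on quintuples, computably

Topic `NumberTheory/NumberFields`, sub-namespace `QuinticRing` (the object). The degree-`5` analogue
of the tree's `CubicRing` (`Literature/NumberTheory/NumberFields/CubicRing.lean`): for a commutative
ring `R` and `p₀ … p₄ : R`, `QuinticRing R p₀ p₁ p₂ p₃ p₄` is the type of quintuples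
`⟨x₀, x₁, x₂, x₃, x₄⟩` ("`x₀ + x₁t + x₂t² + x₃t³ + x₄t⁴`") with the multiplication of
`R[t]/(f)`, `f = t⁵ - p₄t⁴ - p₃t³ - p₂t² - p₁t - p₀`, written out COMPUTABLY: the product of two
quintuples is the degree-`≤ 8` convolution reduced by `t⁵ = p₀ + p₁t + ⋯ + p₄t⁴` in four steps
(`t⁸, t⁷, t⁶, t⁵`). It is a commutative ring (`QuinticRing.instCommRing`), has decidable equality
and is finite when `R` is, so that statements quantified over `QuinticRing (ZMod 4) …`
(`= 𝓞_K/4𝓞_K` for a monogenic quintic field in which `2` is inert) are decided by the kernel —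
the use made of it by the explicit `2`-descent over the quintic field `ℚ(ζ₁₁)⁺` of
`Literature/NumberTheory/NumberFields/CyclicQuinticField11*.lean`.

Design. Instead of closing the ring axioms by `ring` on the (large) closed-form coefficients, we
map quintuples to Mathlib's (non-computable) `AdjoinRoot f` by
`toAdj ⟨x₀,…,x₄⟩ = [x₀ + x₁X + ⋯ + x₄X⁴]`, prove that this map is injective (a non-zero polynomial
of degree `< 5` is not a multiple of the monic quintic `f`) and multiplicative (the one polynomial
identity `toPoly_mul`: `U·V = (U ⋆ V) + f · Q` with the explicit quotient `Q` of the four reduction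
steps), and pull the axioms back (`mul_assoc` etc. hold in `AdjoinRoot f`). The data fields of the
instance are the computable operations. `gen_pow_five`: `t⁵ = ⟨p₀, p₁, p₂, p₃, p₄⟩`; `gen_root`: the
monic integer form `t⁵ + a₄t⁴ + ⋯ + a₀ = 0` for `pᵢ = -aᵢ`. No number theory is proved here.

## References

* D. A. Marcus, *Number Fields*, 2nd ed. (2018), Ch. 2 (orders `ℤ[θ]` and their quotients).
  [folklore]
-/

open Polynomial

namespace Literature.NumberTheory.NumberFields

/-- Quintuples `⟨x₀, x₁, x₂, x₃, x₄⟩ = x₀ + x₁ t + x₂ t² + x₃ t³ + x₄ t⁴` over `R`: the carrier of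
`R[t]/(t⁵ - p₄t⁴ - p₃t³ - p₂t² - p₁t - p₀)`. The parameters only enter the multiplication.
[folklore] -/
@[ext]
structure QuinticRing (R : Type*) (p0 p1 p2 p3 p4 : R) where
  /-- constant coefficient -/
  c0 : R
  /-- coefficient of `t` -/
  c1 : R
  /-- coefficient of `t²` -/
  c2 : R
  /-- coefficient of `t³` -/
  c3 : R
  /-- coefficient of `t⁴` -/
  c4 : R
  deriving DecidableEq

namespace QuinticRing

variable {R : Type*} [CommRing R] {p0 p1 p2 p3 p4 : R}

/-- Quintuples as an iterated product (for transferring instances). [folklore] -/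
def equivProd (R : Type*) (p0 p1 p2 p3 p4 : R) :
    QuinticRing R p0 p1 p2 p3 p4 ≃ R × R × R × R × R where
  toFun u := (u.c0, u.c1, u.c2, u.c3, u.c4)
  invFun v := ⟨v.1, v.2.1, v.2.2.1, v.2.2.2.1, v.2.2.2.2⟩
  left_inv _ := rfl
  right_inv _ := rfl

/-- Finitely many quintuples over a finite ring (computably, for `decide`). [folklore] -/
instance [Fintype R] : Fintype (QuinticRing R p0 p1 p2 p3 p4) :=
  Fintype.ofEquiv _ (equivProd R p0 p1 p2 p3 p4).symm

/-- Addition is componentwise. [folklore] -/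
instance : Add (QuinticRing R p0 p1 p2 p3 p4) :=
  ⟨fun u v => ⟨u.c0 + v.c0, u.c1 + v.c1, u.c2 + v.c2, u.c3 + v.c3, u.c4 + v.c4⟩⟩
/-- Zero. [folklore] -/
instance : Zero (QuinticRing R p0 p1 p2 p3 p4) := ⟨⟨0, 0, 0, 0, 0⟩⟩
/-- Negation is componentwise. [folklore] -/
instance : Neg (QuinticRing R p0 p1 p2 p3 p4) := ⟨fun u => ⟨-u.c0, -u.c1, -u.c2, -u.c3, -u.c4⟩⟩
/-- Subtraction is componentwise. [folklore] -/
instance : Sub (QuinticRing R p0 p1 p2 p3 p4) :=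
  ⟨fun u v => ⟨u.c0 - v.c0, u.c1 - v.c1, u.c2 - v.c2, u.c3 - v.c3, u.c4 - v.c4⟩⟩
/-- One is `⟨1, 0, 0, 0, 0⟩`. [folklore] -/
instance : One (QuinticRing R p0 p1 p2 p3 p4) := ⟨⟨1, 0, 0, 0, 0⟩⟩
/-- Natural number literals `⟨n, 0, 0, 0, 0⟩`. [folklore] -/
instance : NatCast (QuinticRing R p0 p1 p2 p3 p4) := ⟨fun n => ⟨n, 0, 0, 0, 0⟩⟩
/-- Integer literals `⟨n, 0, 0, 0, 0⟩`. [folklore] -/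
instance : IntCast (QuinticRing R p0 p1 p2 p3 p4) := ⟨fun n => ⟨n, 0, 0, 0, 0⟩⟩
/-- Scalar multiplication by naturals, componentwise. [folklore] -/
instance : SMul ℕ (QuinticRing R p0 p1 p2 p3 p4) :=
  ⟨fun n u => ⟨n • u.c0, n • u.c1, n • u.c2, n • u.c3, n • u.c4⟩⟩
/-- Scalar multiplication by integers, componentwise. [folklore] -/
instance : SMul ℤ (QuinticRing R p0 p1 p2 p3 p4) :=
  ⟨fun n u => ⟨n • u.c0, n • u.c1, n • u.c2, n • u.c3, n • u.c4⟩⟩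

/-- The coefficient of `t⁸` of the convolution (first reduction step). [folklore] -/
def q3 (u v : QuinticRing R p0 p1 p2 p3 p4) : R := u.c4 * v.c4
/-- The coefficient of `t⁷` after reducing `t⁸` (second reduction step). [folklore] -/
def q2 (u v : QuinticRing R p0 p1 p2 p3 p4) : R := u.c3 * v.c4 + u.c4 * v.c3 + q3 u v * p4
/-- The coefficient of `t⁶` after reducing `t⁸, t⁷` (third reduction step). [folklore] -/
def q1 (u v : QuinticRing R p0 p1 p2 p3 p4) : R :=
  u.c2 * v.c4 + u.c3 * v.c3 + u.c4 * v.c2 + q3 u v * p3 + q2 u v * p4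
/-- The coefficient of `t⁵` after reducing `t⁸, t⁷, t⁶` (last reduction step). [folklore] -/
def q0 (u v : QuinticRing R p0 p1 p2 p3 p4) : R :=
  u.c1 * v.c4 + u.c2 * v.c3 + u.c3 * v.c2 + u.c4 * v.c1 + q3 u v * p2 + q2 u v * p3 + q1 u v * p4

/-- **Multiplication** of quintuples modulo `t⁵ = p₀ + p₁t + p₂t² + p₃t³ + p₄t⁴`: the convolution,
with `qₖ tᵏ⁺⁵` replaced by `qₖ tᵏ (p₀ + ⋯ + p₄t⁴)` for `k = 3, 2, 1, 0` in turn. [folklore] -/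
instance : Mul (QuinticRing R p0 p1 p2 p3 p4) :=
  ⟨fun u v =>
    ⟨u.c0 * v.c0 + q0 u v * p0,
     u.c0 * v.c1 + u.c1 * v.c0 + q1 u v * p0 + q0 u v * p1,
     u.c0 * v.c2 + u.c1 * v.c1 + u.c2 * v.c0 + q2 u v * p0 + q1 u v * p1 + q0 u v * p2,
     u.c0 * v.c3 + u.c1 * v.c2 + u.c2 * v.c1 + u.c3 * v.c0 + q3 u v * p0 + q2 u v * p1 +
       q1 u v * p2 + q0 u v * p3,
     u.c0 * v.c4 + u.c1 * v.c3 + u.c2 * v.c2 + u.c3 * v.c1 + u.c4 * v.c0 + q3 u v * p1 +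
       q2 u v * p2 + q1 u v * p3 + q0 u v * p4⟩⟩

/-- Powers by iterated multiplication (computable). [folklore] -/
instance : Pow (QuinticRing R p0 p1 p2 p3 p4) ℕ := ⟨fun u n => npowRec n u⟩

section simpLemmas

variable (u v : QuinticRing R p0 p1 p2 p3 p4)

/-- coefficients of `add`. [folklore] -/
@[simp] theorem add_c0 : (u + v).c0 = u.c0 + v.c0 := rfl
/-- coefficients of `add`. [folklore] -/
@[simp] theorem add_c1 : (u + v).c1 = u.c1 + v.c1 := rfl
/-- coefficients of `add`. [folklore] -/
@[simp] theorem add_c2 : (u + v).c2 = u.c2 + v.c2 := rfl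
/-- coefficients of `add`. [folklore] -/
@[simp] theorem add_c3 : (u + v).c3 = u.c3 + v.c3 := rfl
/-- coefficients of `add`. [folklore] -/
@[simp] theorem add_c4 : (u + v).c4 = u.c4 + v.c4 := rfl
/-- coefficients of `zero`. [folklore] -/
@[simp] theorem zero_c0 : (0 : QuinticRing R p0 p1 p2 p3 p4).c0 = 0 := rfl
/-- coefficients of `zero`. [folklore] -/
@[simp] theorem zero_c1 : (0 : QuinticRing R p0 p1 p2 p3 p4).c1 = 0 := rfl
/-- coefficients of `zero`. [folklore] -/
@[simp] theorem zero_c2 : (0 : QuinticRing R p0 p1 p2 p3 p4).c2 = 0 := rfl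
/-- coefficients of `zero`. [folklore] -/
@[simp] theorem zero_c3 : (0 : QuinticRing R p0 p1 p2 p3 p4).c3 = 0 := rfl
/-- coefficients of `zero`. [folklore] -/
@[simp] theorem zero_c4 : (0 : QuinticRing R p0 p1 p2 p3 p4).c4 = 0 := rfl
/-- coefficients of `neg`. [folklore] -/
@[simp] theorem neg_c0 : (-u).c0 = -u.c0 := rfl
/-- coefficients of `neg`. [folklore] -/
@[simp] theorem neg_c1 : (-u).c1 = -u.c1 := rfl
/-- coefficients of `neg`. [folklore] -/
@[simp] theorem neg_c2 : (-u).c2 = -u.c2 := rfl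
/-- coefficients of `neg`. [folklore] -/
@[simp] theorem neg_c3 : (-u).c3 = -u.c3 := rfl
/-- coefficients of `neg`. [folklore] -/
@[simp] theorem neg_c4 : (-u).c4 = -u.c4 := rfl
/-- coefficients of `sub`. [folklore] -/
@[simp] theorem sub_c0 : (u - v).c0 = u.c0 - v.c0 := rfl
/-- coefficients of `sub`. [folklore] -/
@[simp] theorem sub_c1 : (u - v).c1 = u.c1 - v.c1 := rfl
/-- coefficients of `sub`. [folklore] -/
@[simp] theorem sub_c2 : (u - v).c2 = u.c2 - v.c2 := rfl
/-- coefficients of `sub`. [folklore] -/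
@[simp] theorem sub_c3 : (u - v).c3 = u.c3 - v.c3 := rfl
/-- coefficients of `sub`. [folklore] -/
@[simp] theorem sub_c4 : (u - v).c4 = u.c4 - v.c4 := rfl
/-- coefficients of `one`. [folklore] -/
@[simp] theorem one_c0 : (1 : QuinticRing R p0 p1 p2 p3 p4).c0 = 1 := rfl
/-- coefficients of `one`. [folklore] -/
@[simp] theorem one_c1 : (1 : QuinticRing R p0 p1 p2 p3 p4).c1 = 0 := rfl
/-- coefficients of `one`. [folklore] -/
@[simp] theorem one_c2 : (1 : QuinticRing R p0 p1 p2 p3 p4).c2 = 0 := rfl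
/-- coefficients of `one`. [folklore] -/
@[simp] theorem one_c3 : (1 : QuinticRing R p0 p1 p2 p3 p4).c3 = 0 := rfl
/-- coefficients of `one`. [folklore] -/
@[simp] theorem one_c4 : (1 : QuinticRing R p0 p1 p2 p3 p4).c4 = 0 := rfl
/-- coefficients of `natCast`. [folklore] -/
@[simp] theorem natCast_c0 (n : ℕ) : (n : QuinticRing R p0 p1 p2 p3 p4).c0 = n := rfl
/-- coefficients of `natCast`. [folklore] -/
@[simp] theorem natCast_c1 (n : ℕ) : (n : QuinticRing R p0 p1 p2 p3 p4).c1 = 0 := rfl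
/-- coefficients of `natCast`. [folklore] -/
@[simp] theorem natCast_c2 (n : ℕ) : (n : QuinticRing R p0 p1 p2 p3 p4).c2 = 0 := rfl
/-- coefficients of `natCast`. [folklore] -/
@[simp] theorem natCast_c3 (n : ℕ) : (n : QuinticRing R p0 p1 p2 p3 p4).c3 = 0 := rfl
/-- coefficients of `natCast`. [folklore] -/
@[simp] theorem natCast_c4 (n : ℕ) : (n : QuinticRing R p0 p1 p2 p3 p4).c4 = 0 := rfl
/-- coefficients of `intCast`. [folklore] -/
@[simp] theorem intCast_c0 (n : ℤ) : (n : QuinticRing R p0 p1 p2 p3 p4).c0 = n := rfl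
/-- coefficients of `intCast`. [folklore] -/
@[simp] theorem intCast_c1 (n : ℤ) : (n : QuinticRing R p0 p1 p2 p3 p4).c1 = 0 := rfl
/-- coefficients of `intCast`. [folklore] -/
@[simp] theorem intCast_c2 (n : ℤ) : (n : QuinticRing R p0 p1 p2 p3 p4).c2 = 0 := rfl
/-- coefficients of `intCast`. [folklore] -/
@[simp] theorem intCast_c3 (n : ℤ) : (n : QuinticRing R p0 p1 p2 p3 p4).c3 = 0 := rfl
/-- coefficients of `intCast`. [folklore] -/
@[simp] theorem intCast_c4 (n : ℤ) : (n : QuinticRing R p0 p1 p2 p3 p4).c4 = 0 := rfl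
/-- coefficients of `nsmul`. [folklore] -/
@[simp] theorem nsmul_def (n : ℕ) : n • u = ⟨n • u.c0, n • u.c1, n • u.c2, n • u.c3, n • u.c4⟩ := rfl
/-- coefficients of `zsmul`. [folklore] -/
@[simp] theorem zsmul_def (n : ℤ) : n • u = ⟨n • u.c0, n • u.c1, n • u.c2, n • u.c3, n • u.c4⟩ := rfl
/-- `u ^ 0 = 1`. [folklore] -/
theorem pow_zero' : u ^ 0 = 1 := rfl
/-- `u ^ (n+1) = u ^ n * u`. [folklore] -/
theorem pow_succ' (n : ℕ) : u ^ (n + 1) = u ^ n * u := rfl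

/-- coefficients of `mul`. [folklore] -/
theorem mul_c0 : (u * v).c0 = u.c0 * v.c0 + q0 u v * p0 := rfl
/-- coefficients of `mul`. [folklore] -/
theorem mul_c1 : (u * v).c1 = u.c0 * v.c1 + u.c1 * v.c0 + q1 u v * p0 + q0 u v * p1 := rfl
/-- coefficients of `mul`. [folklore] -/
theorem mul_c2 : (u * v).c2 =
    u.c0 * v.c2 + u.c1 * v.c1 + u.c2 * v.c0 + q2 u v * p0 + q1 u v * p1 + q0 u v * p2 := rfl
/-- coefficients of `mul`. [folklore] -/
theorem mul_c3 : (u * v).c3 = u.c0 * v.c3 + u.c1 * v.c2 + u.c2 * v.c1 + u.c3 * v.c0 +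
    q3 u v * p0 + q2 u v * p1 + q1 u v * p2 + q0 u v * p3 := rfl
/-- coefficients of `mul`. [folklore] -/
theorem mul_c4 : (u * v).c4 = u.c0 * v.c4 + u.c1 * v.c3 + u.c2 * v.c2 + u.c3 * v.c1 +
    u.c4 * v.c0 + q3 u v * p1 + q2 u v * p2 + q1 u v * p3 + q0 u v * p4 := rfl

end simpLemmas

/-! ### The comparison with `AdjoinRoot f` -/

section Adj

variable (p0 p1 p2 p3 p4)

/-- The defining polynomial `f = X⁵ - p₄X⁴ - p₃X³ - p₂X² - p₁X - p₀ ∈ R[X]`. [folklore] -/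
noncomputable def poly : R[X] :=
  X ^ 5 - C p4 * X ^ 4 - C p3 * X ^ 3 - C p2 * X ^ 2 - C p1 * X - C p0

/-- `f` is monic. [folklore] -/
theorem monic_poly : (poly p0 p1 p2 p3 p4).Monic := by
  unfold poly
  monicity!

/-- `f` has degree `5` (over a non-trivial ring). [folklore] -/
theorem natDegree_poly [Nontrivial R] : (poly p0 p1 p2 p3 p4).natDegree = 5 := by
  unfold poly
  compute_degree!

variable {p0 p1 p2 p3 p4}

/-- The polynomial `x₀ + x₁X + ⋯ + x₄X⁴` of a quintuple. [folklore] -/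
noncomputable def toPoly (u : QuinticRing R p0 p1 p2 p3 p4) : R[X] :=
  C u.c0 + C u.c1 * X + C u.c2 * X ^ 2 + C u.c3 * X ^ 3 + C u.c4 * X ^ 4

/-- The coefficients of `toPoly u` in degrees `< 5` are the coordinates of `u`, and `0` above.
[folklore] -/
theorem coeff_toPoly (u : QuinticRing R p0 p1 p2 p3 p4) (n : ℕ) :
    (toPoly u).coeff n = if n = 0 then u.c0 else if n = 1 then u.c1 else if n = 2 then u.c2
      else if n = 3 then u.c3 else if n = 4 then u.c4 else 0 := by
  simp only [toPoly, coeff_add, coeff_C, coeff_C_mul, coeff_X, coeff_X_pow]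
  rcases n with _ | _ | _ | _ | _ | n <;> simp

/-- `toPoly u` has degree `< 5`. [folklore] -/
theorem degree_toPoly_lt (u : QuinticRing R p0 p1 p2 p3 p4) : (toPoly u).degree < 5 := by
  refine (degree_le_iff_coeff_zero _ 4).mpr (fun n hn => ?_) |>.trans_lt (by norm_num)
  rw [coeff_toPoly]
  have h4 : 4 < n := by exact_mod_cast hn
  rcases n with _ | _ | _ | _ | _ | n <;> simp_all

/-- `toPoly` is injective. [folklore] -/
theorem toPoly_injective : Function.Injective (toPoly (p0 := p0) (p1 := p1) (p2 := p2)
    (p3 := p3) (p4 := p4)) := by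
  intro u v h
  have hc := fun n => congrArg (fun q : R[X] => q.coeff n) h
  have h0 := hc 0; have h1 := hc 1; have h2 := hc 2; have h3 := hc 3; have h4 := hc 4
  simp only [coeff_toPoly] at h0 h1 h2 h3 h4
  ext <;> simp_all

/-- `toPoly` is additive. [folklore] -/
theorem toPoly_add (u v : QuinticRing R p0 p1 p2 p3 p4) :
    toPoly (u + v) = toPoly u + toPoly v := by
  simp only [toPoly, add_c0, add_c1, add_c2, add_c3, add_c4, map_add]
  ring

/-- **The reduction identity**: `U · V = (U ⋆ V) + f · (q₃X³ + q₂X² + q₁X + q₀)`, where `⋆` is the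
multiplication of quintuples and `q₃, q₂, q₁, q₀` are the coefficients eliminated in the four
reduction steps. [folklore] -/
theorem toPoly_mul (u v : QuinticRing R p0 p1 p2 p3 p4) :
    toPoly u * toPoly v = toPoly (u * v) + poly p0 p1 p2 p3 p4 *
      (C (q3 u v) * X ^ 3 + C (q2 u v) * X ^ 2 + C (q1 u v) * X + C (q0 u v)) := by
  simp only [toPoly, poly, mul_c0, mul_c1, mul_c2, mul_c3, mul_c4, q0, q1, q2, q3, map_add,
    map_mul]
  ring

variable (p0 p1 p2 p3 p4) in
/-- The comparison map `⟨x₀,…,x₄⟩ ↦ [x₀ + x₁X + ⋯ + x₄X⁴] ∈ R[X]/(f)`. [folklore] -/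
noncomputable def toAdj (u : QuinticRing R p0 p1 p2 p3 p4) : AdjoinRoot (poly p0 p1 p2 p3 p4) :=
  AdjoinRoot.mk _ (toPoly u)

/-- `toAdj` is injective: a polynomial of degree `< 5` divisible by the monic quintic `f` is `0`.
[folklore] -/
theorem toAdj_injective : Function.Injective (toAdj p0 p1 p2 p3 p4) := by
  intro u v h
  rcases subsingleton_or_nontrivial R with hR | hR
  · ext <;> exact Subsingleton.elim _ _
  apply toPoly_injective
  have hdvd : poly p0 p1 p2 p3 p4 ∣ toPoly u - toPoly v := AdjoinRoot.mk_eq_mk.mp h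
  have hdeg : (toPoly u - toPoly v).degree < (poly p0 p1 p2 p3 p4).degree := by
    rw [degree_eq_natDegree (monic_poly p0 p1 p2 p3 p4).ne_zero, natDegree_poly]
    exact (degree_sub_le _ _).trans_lt (max_lt (degree_toPoly_lt u) (degree_toPoly_lt v))
  by_contra hne
  exact (monic_poly p0 p1 p2 p3 p4).not_dvd_of_degree_lt (sub_ne_zero.mpr hne) hdeg hdvd

/-- `toAdj 0 = 0`. [folklore] -/
theorem toAdj_zero : toAdj p0 p1 p2 p3 p4 0 = 0 := by
  simp [toAdj, toPoly]

/-- `toAdj 1 = 1`. [folklore] -/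
theorem toAdj_one : toAdj p0 p1 p2 p3 p4 1 = 1 := by
  simp [toAdj, toPoly]

/-- `toAdj` is additive. [folklore] -/
theorem toAdj_add (u v : QuinticRing R p0 p1 p2 p3 p4) :
    toAdj p0 p1 p2 p3 p4 (u + v) = toAdj p0 p1 p2 p3 p4 u + toAdj p0 p1 p2 p3 p4 v := by
  simp only [toAdj, toPoly_add, map_add]

/-- `toAdj` is multiplicative (from `toPoly_mul`: the error term is a multiple of `f`). [folklore] -/
theorem toAdj_mul (u v : QuinticRing R p0 p1 p2 p3 p4) :
    toAdj p0 p1 p2 p3 p4 (u * v) = toAdj p0 p1 p2 p3 p4 u * toAdj p0 p1 p2 p3 p4 v := by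
  rw [toAdj, toAdj, toAdj, ← map_mul, toPoly_mul, map_add, map_mul, AdjoinRoot.mk_self, zero_mul,
    add_zero]

/-- `toPoly` commutes with negation. [folklore] -/
theorem toPoly_neg (u : QuinticRing R p0 p1 p2 p3 p4) : toPoly (-u) = -toPoly u := by
  simp only [toPoly, neg_c0, neg_c1, neg_c2, neg_c3, neg_c4, map_neg]
  ring

/-- `toAdj` commutes with negation. [folklore] -/
theorem toAdj_neg (u : QuinticRing R p0 p1 p2 p3 p4) :
    toAdj p0 p1 p2 p3 p4 (-u) = -toAdj p0 p1 p2 p3 p4 u := by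
  rw [toAdj, toAdj, toPoly_neg, map_neg]

/-- `toPoly` commutes with subtraction. [folklore] -/
theorem toPoly_sub (u v : QuinticRing R p0 p1 p2 p3 p4) : toPoly (u - v) = toPoly u - toPoly v := by
  simp only [toPoly, sub_c0, sub_c1, sub_c2, sub_c3, sub_c4, map_sub]
  ring

/-- `toAdj` commutes with subtraction. [folklore] -/
theorem toAdj_sub (u v : QuinticRing R p0 p1 p2 p3 p4) :
    toAdj p0 p1 p2 p3 p4 (u - v) = toAdj p0 p1 p2 p3 p4 u - toAdj p0 p1 p2 p3 p4 v := by
  rw [toAdj, toAdj, toAdj, toPoly_sub, map_sub]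

/-- `toPoly (n • u) = n · toPoly u` for `n : ℕ`. [folklore] -/
theorem toPoly_nsmul (n : ℕ) (u : QuinticRing R p0 p1 p2 p3 p4) :
    toPoly (n • u) = (n : R[X]) * toPoly u := by
  simp only [toPoly, nsmul_def, nsmul_eq_mul, map_mul, map_natCast]
  ring

/-- `toAdj` commutes with `ℕ`-scalar multiplication. [folklore] -/
theorem toAdj_nsmul (n : ℕ) (u : QuinticRing R p0 p1 p2 p3 p4) :
    toAdj p0 p1 p2 p3 p4 (n • u) = n • toAdj p0 p1 p2 p3 p4 u := by
  rw [toAdj, toAdj, toPoly_nsmul, map_mul, map_natCast, nsmul_eq_mul]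

/-- `toPoly (n • u) = n · toPoly u` for `n : ℤ`. [folklore] -/
theorem toPoly_zsmul (n : ℤ) (u : QuinticRing R p0 p1 p2 p3 p4) :
    toPoly (n • u) = (n : R[X]) * toPoly u := by
  simp only [toPoly, zsmul_def, zsmul_eq_mul, map_mul, map_intCast]
  ring

/-- `toAdj` commutes with `ℤ`-scalar multiplication. [folklore] -/
theorem toAdj_zsmul (n : ℤ) (u : QuinticRing R p0 p1 p2 p3 p4) :
    toAdj p0 p1 p2 p3 p4 (n • u) = n • toAdj p0 p1 p2 p3 p4 u := by
  rw [toAdj, toAdj, toPoly_zsmul, map_mul, map_intCast, zsmul_eq_mul]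

/-- `toAdj` sends natural number literals to themselves. [folklore] -/
theorem toAdj_natCast (n : ℕ) : toAdj p0 p1 p2 p3 p4 (n : QuinticRing R p0 p1 p2 p3 p4) = n := by
  simp only [toAdj, toPoly, natCast_c0, natCast_c1, natCast_c2, natCast_c3, natCast_c4, map_zero,
    zero_mul, add_zero, map_natCast]

/-- `toAdj` sends integer literals to themselves. [folklore] -/
theorem toAdj_intCast (n : ℤ) : toAdj p0 p1 p2 p3 p4 (n : QuinticRing R p0 p1 p2 p3 p4) = n := by
  simp only [toAdj, toPoly, intCast_c0, intCast_c1, intCast_c2, intCast_c3, intCast_c4, map_zero,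
    zero_mul, add_zero, map_intCast]

/-- `toAdj` commutes with powers. [folklore] -/
theorem toAdj_pow (u : QuinticRing R p0 p1 p2 p3 p4) (n : ℕ) :
    toAdj p0 p1 p2 p3 p4 (u ^ n) = toAdj p0 p1 p2 p3 p4 u ^ n := by
  induction n with
  | zero => rw [pow_zero', pow_zero, toAdj_one]
  | succ n ih => rw [pow_succ', toAdj_mul, ih, pow_succ]

end Adj

/-- **`R[t]/(t⁵ - p₄t⁴ - ⋯ - p₀)` is a commutative ring**: the axioms are pulled back along the
injective multiplicative map `toAdj` to Mathlib's `AdjoinRoot f`; the data are the computable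
operations above. [folklore] -/
instance instCommRing : CommRing (QuinticRing R p0 p1 p2 p3 p4) where
  add_assoc u v w := by ext <;> simp [add_assoc]
  zero_add u := by ext <;> simp
  add_zero u := by ext <;> simp
  add_comm u v := by ext <;> simp [add_comm]
  neg_add_cancel u := by ext <;> simp
  sub_eq_add_neg u v := by ext <;> simp [sub_eq_add_neg]
  nsmul n u := n • u
  nsmul_zero u := by ext <;> simp
  nsmul_succ n u := by ext <;> simp [add_mul, add_comm]
  zsmul n u := n • u
  zsmul_zero' u := by ext <;> simp
  zsmul_succ' n u := by ext <;> simp [add_mul, add_comm]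
  zsmul_neg' n u := by ext <;> simp [add_mul, Int.negSucc_eq, Int.cast_add]
  left_distrib u v w := toAdj_injective (by
    simp only [toAdj_mul, toAdj_add, mul_add])
  right_distrib u v w := toAdj_injective (by
    simp only [toAdj_mul, toAdj_add, add_mul])
  zero_mul u := toAdj_injective (by simp only [toAdj_mul, toAdj_zero, zero_mul])
  mul_zero u := toAdj_injective (by simp only [toAdj_mul, toAdj_zero, mul_zero])
  mul_assoc u v w := toAdj_injective (by simp only [toAdj_mul, mul_assoc])
  one_mul u := toAdj_injective (by simp only [toAdj_mul, toAdj_one, one_mul])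
  mul_one u := toAdj_injective (by simp only [toAdj_mul, toAdj_one, mul_one])
  mul_comm u v := toAdj_injective (by simp only [toAdj_mul, mul_comm])
  npow n u := u ^ n
  npow_zero u := rfl
  npow_succ n u := rfl
  natCast_zero := by ext <;> simp
  natCast_succ n := by ext <;> simp
  intCast_ofNat n := by ext <;> simp
  intCast_negSucc n := by ext <;> simp [Int.negSucc_eq]

/-- `toAdj` as a ring homomorphism `QuinticRing R p → R[X]/(f)`. [folklore] -/
noncomputable def toAdjHom : QuinticRing R p0 p1 p2 p3 p4 →+* AdjoinRoot (poly p0 p1 p2 p3 p4) where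
  toFun := toAdj p0 p1 p2 p3 p4
  map_one' := toAdj_one
  map_mul' := toAdj_mul
  map_zero' := toAdj_zero
  map_add' := toAdj_add

/-- `toAdjHom` is `toAdj`. [folklore] -/
@[simp] theorem toAdjHom_apply (u : QuinticRing R p0 p1 p2 p3 p4) :
    toAdjHom u = toAdj p0 p1 p2 p3 p4 u := rfl

/-- `toAdjHom` is injective. [folklore] -/
theorem toAdjHom_injective : Function.Injective (toAdjHom (p0 := p0) (p1 := p1) (p2 := p2)
    (p3 := p3) (p4 := p4)) := toAdj_injective

/-- The generator `t = ⟨0, 1, 0, 0, 0⟩`. [folklore] -/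
def gen (R : Type*) [CommRing R] (p0 p1 p2 p3 p4 : R) : QuinticRing R p0 p1 p2 p3 p4 := ⟨0, 1, 0, 0, 0⟩

/-- `toAdj t = root f`. [folklore] -/
theorem toAdj_gen : toAdj p0 p1 p2 p3 p4 (gen R p0 p1 p2 p3 p4) = AdjoinRoot.root _ := by
  have h : toPoly (gen R p0 p1 p2 p3 p4) = X := by
    simp only [toPoly, gen, map_zero, map_one, zero_mul, one_mul, zero_add, add_zero]
  rw [toAdj, h, AdjoinRoot.mk_X]

/-- `t² = ⟨0, 0, 1, 0, 0⟩`. [folklore] -/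
theorem gen_pow_two : gen R p0 p1 p2 p3 p4 ^ 2 = ⟨0, 0, 1, 0, 0⟩ := by
  rw [pow_succ', pow_succ', pow_zero', one_mul]
  ext <;> simp [gen, mul_c0, mul_c1, mul_c2, mul_c3, mul_c4, q0, q1, q2, q3]

/-- `t³ = ⟨0, 0, 0, 1, 0⟩`. [folklore] -/
theorem gen_pow_three : gen R p0 p1 p2 p3 p4 ^ 3 = ⟨0, 0, 0, 1, 0⟩ := by
  rw [pow_succ', gen_pow_two]
  ext <;> simp [gen, mul_c0, mul_c1, mul_c2, mul_c3, mul_c4, q0, q1, q2, q3]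

/-- `t⁴ = ⟨0, 0, 0, 0, 1⟩`. [folklore] -/
theorem gen_pow_four : gen R p0 p1 p2 p3 p4 ^ 4 = ⟨0, 0, 0, 0, 1⟩ := by
  rw [pow_succ', gen_pow_three]
  ext <;> simp [gen, mul_c0, mul_c1, mul_c2, mul_c3, mul_c4, q0, q1, q2, q3]

/-- **The defining relation** `t⁵ = p₀ + p₁t + p₂t² + p₃t³ + p₄t⁴`. [folklore] -/
theorem gen_pow_five : gen R p0 p1 p2 p3 p4 ^ 5 = ⟨p0, p1, p2, p3, p4⟩ := by
  rw [pow_succ', gen_pow_four]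
  ext <;> simp [gen, mul_c0, mul_c1, mul_c2, mul_c3, mul_c4, q0, q1, q2, q3]

/-- The "constants" map `x ↦ ⟨x, 0, 0, 0, 0⟩` as a ring homomorphism. [folklore] -/
def const : R →+* QuinticRing R p0 p1 p2 p3 p4 where
  toFun x := ⟨x, 0, 0, 0, 0⟩
  map_one' := rfl
  map_mul' x y := by ext <;> simp [mul_c0, mul_c1, mul_c2, mul_c3, mul_c4, q0, q1, q2, q3]
  map_zero' := rfl
  map_add' x y := by ext <;> simp

/-- coefficients of `const`. [folklore] -/
@[simp] theorem const_c0 (x : R) : (const x : QuinticRing R p0 p1 p2 p3 p4).c0 = x := rfl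
/-- coefficients of `const`. [folklore] -/
@[simp] theorem const_c1 (x : R) : (const x : QuinticRing R p0 p1 p2 p3 p4).c1 = 0 := rfl
/-- coefficients of `const`. [folklore] -/
@[simp] theorem const_c2 (x : R) : (const x : QuinticRing R p0 p1 p2 p3 p4).c2 = 0 := rfl
/-- coefficients of `const`. [folklore] -/
@[simp] theorem const_c3 (x : R) : (const x : QuinticRing R p0 p1 p2 p3 p4).c3 = 0 := rfl
/-- coefficients of `const`. [folklore] -/
@[simp] theorem const_c4 (x : R) : (const x : QuinticRing R p0 p1 p2 p3 p4).c4 = 0 := rfl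

/-- The coordinates of `x₀ + x₁t + ⋯ + x₄t⁴` are `(x₀, …, x₄)`. [folklore] -/
theorem eq_lin (u : QuinticRing R p0 p1 p2 p3 p4) :
    u = const u.c0 + const u.c1 * gen R p0 p1 p2 p3 p4 + const u.c2 * gen R p0 p1 p2 p3 p4 ^ 2 +
      const u.c3 * gen R p0 p1 p2 p3 p4 ^ 3 + const u.c4 * gen R p0 p1 p2 p3 p4 ^ 4 := by
  rw [gen_pow_two, gen_pow_three, gen_pow_four]
  ext <;> simp [gen, mul_c0, mul_c1, mul_c2, mul_c3, mul_c4, q0, q1, q2, q3]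

/-- The defining relation in monic integer form: `t⁵ + a₄t⁴ + a₃t³ + a₂t² + a₁t + a₀ = 0` in
`R[t]/(t⁵ + a₄t⁴ + ⋯ + a₀)`, i.e. for `pᵢ = -aᵢ` (the hypothesis of the universal property of
`ℤ[X]/(F) ≅ 𝓞_K` for the target `QuinticRing R (-a₀) (-a₁) (-a₂) (-a₃) (-a₄)`). [folklore] -/
theorem gen_root (a0 a1 a2 a3 a4 : ℤ) :
    gen R (-(a0 : R)) (-(a1 : R)) (-(a2 : R)) (-(a3 : R)) (-(a4 : R)) ^ 5 +
      (a4 : QuinticRing R (-(a0 : R)) (-(a1 : R)) (-(a2 : R)) (-(a3 : R)) (-(a4 : R))) *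
        gen R (-(a0 : R)) (-(a1 : R)) (-(a2 : R)) (-(a3 : R)) (-(a4 : R)) ^ 4 +
      (a3 : QuinticRing R (-(a0 : R)) (-(a1 : R)) (-(a2 : R)) (-(a3 : R)) (-(a4 : R))) *
        gen R (-(a0 : R)) (-(a1 : R)) (-(a2 : R)) (-(a3 : R)) (-(a4 : R)) ^ 3 +
      (a2 : QuinticRing R (-(a0 : R)) (-(a1 : R)) (-(a2 : R)) (-(a3 : R)) (-(a4 : R))) *
        gen R (-(a0 : R)) (-(a1 : R)) (-(a2 : R)) (-(a3 : R)) (-(a4 : R)) ^ 2 +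
      (a1 : QuinticRing R (-(a0 : R)) (-(a1 : R)) (-(a2 : R)) (-(a3 : R)) (-(a4 : R))) *
        gen R (-(a0 : R)) (-(a1 : R)) (-(a2 : R)) (-(a3 : R)) (-(a4 : R)) +
      (a0 : QuinticRing R (-(a0 : R)) (-(a1 : R)) (-(a2 : R)) (-(a3 : R)) (-(a4 : R))) = 0 := by
  rw [gen_pow_five, gen_pow_four, gen_pow_three, gen_pow_two]
  ext <;> simp [gen, mul_c0, mul_c1, mul_c2, mul_c3, mul_c4, q0, q1, q2, q3]

end QuinticRing

end Literature.NumberTheory.NumberFields
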